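import Literature.MathematicalPhysics.QuantumFieldTheory.Balaban1983to89.B9Ineq346SecondOrderTorusCore

/-!
# `Balaban1983to89.B9Ineq346SecondOrderTorusCutoff` — [B9] (3.46) AT `U = 1`, THE SECOND-ORDER MEMBERS: the SMOOTH
CUT-OFF AT THE BLOCK SCALE on the genuine `k`-level torus (file 2 of the second-order programme of seat dag-n06-h g3)

T. Bałaban, *Propagators for lattice gauge theories in a background field*, Commun. Math. Phys. **99** (1985) 389–434
[`Balaban1985BackgroundPropagators`, "B9"]; [4] = T. Bałaban, *Propagators and renormalization transformations for lattice
gauge theories. II*, Commun. Math. Phys. **96** (1984) 223–250 [`Balaban1984PropagatorsII`].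

statement-level skeleton of published theorems with citation tags; proofs where landed; nothing here is a claim about the
Yang–Mills mass gap

THE PRINTED LOCI (verbatim).  (3.46), p. 398 (the six `L²` members, *"supp h ⊂ Δ̃(y), y ∈ Λ_j, supp λ ⊂ Δ(y′)"*); [4] (2.45)–(2.46)
p. 231 (the blocks `𝔅 = ⋃_j Λ_j` and the distance `d(y, y′)`), (2.2) p. 224 (*"(L^jη)^{−1}dist(Ω_j^c, Ω_{j+1}) > RM"*).

THE POINT.  The local energy estimates of `B9Ineq346SecondOrderTorusCore` (Caccioppoli, the H² identity with the product
rule) need, for every block `B(y)` of level `j` of the torus lineage (`B6MultiLevelTorusOperator` ∕ `B6Geom246MultiLevelTorus`),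
a cut-off `χ_y` with: `0 ≤ χ_y ≤ 1`; `χ_y = 1` on `B(y)` and its lattice 2-neighbourhood; `|χ_y(x+e_μ) − χ_y(x)| ≤ K₁L^{−j}`;
`|(−Δχ_y)(x)| ≤ K₂L^{−2j}`; and `χ_y(x) ≠ 0 ⇒ d(y(x), y) ≤ K₀` with the level of `y(x)` within `1` of `j`.  THIS FILE builds it
as a PRODUCT over the coordinates of a discrete C¹ spline profile of the torus distance to the centre of the block:

* §1 the profile `prof n : ℕ → ℝ` — `1 − (partial sums of the tent `T_n`)/S_n`: plateau `s ≤ n + 2`, zero from `3n + 3`, values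
  in `[0, 1]`, first differences `≤ n/S_n`, second differences `≤ 1/S_n`, `2S_n ≥ n(n+1)` (pure finite sums, no calculus);
* §2 the torus distance `circAbs` along one lattice step (`circAbs_succ_le`, `circAbs_three`);
* §3 the one-dimensional cut-off `g(t) = prof n (circAbs N (t − m))`: periodic, plateau, support, first and second differences;
* §4 the product cut-off `cutoffT D y` on the torus and its five properties (`cutoffT_nonneg/le_one`, `cutoffT_plateau…`,
  `cutoffT_lipschitz`, `cutoffT_perLapT_le`, `cutoffT_support`);
* §5 the geometric comparison behind the support property: ★ `distT_blkOf_le_of_torusSupNorm` — TORUS-close sites have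
  `d`-close blocks (p21's box lemma `dist_blkOf_le_box` read in a centred translation chart, `distT_le_dist_chart`) — and the
  level window `scale_window_of_distT_le` (`levelGapT`).

HONEST SCOPE.  Lattice geometry on the discrete torus, kernel-checked; no inequality of [B9] or [4] is asserted.  One finite
lattice programme — nothing continuum, nothing about the mass gap.  Cell `pub-ymgap` (HUMAN RULING D-0062), Track A node N06
[B9], N06-ASSIGNMENT v1 row 11 (bundle F3) at def-Y's instance, seat `pub-ymgap-dag-n06-h` (g3), 2026-08-27.
-/

noncomputable section

namespace Literature.MathematicalPhysics.QuantumFieldTheory.Balaban1983to89.B9Ineq346SecondOrderTorusCutoff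

open Finset Matrix
open B4Reflection242 (boxDom mem_boxDom blk)
open B4ContourShift (supNorm abs_le_supNorm supNorm_nonneg)
open B4TorusKernel.MultiPeriod (torusSupNorm circAbs circAbs_nonneg circAbs_add_mul circAbs_le_abs two_mul_circAbs_le
  torusSupNorm_le_supNorm)
open B6MultiLevelBoxOperator (N0 bigSide one_le_bigSide)
open B6MultiLevelTorusOperator
open B6Geom246MultiLevelBox (bset blkOf corner corner_mem blkOf_corner coord_bounds blkOf_eq_iff_blk lev_eq_of_blkOf_eq
  dist_blkOf_le_box)
open B6Geom246MultiLevelTorus (bondT TouchT bondT_adj connectedT levelGapT blkMap blkMap_blkOf distT_le_dist_chart geomT)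

variable {d : ℕ}

/-! ## §1 The discrete C¹ spline profile -/

section Profile

/-- the tent `T_n(i) = min(i − (n+2), (3n+2) − i)` (truncated subtraction): zero for `i ≤ n + 2` and `i ≥ 3n + 2`, peak `n`
at `i = 2n + 2`, steps of size `≤ 1`. [cite: Balaban1985BackgroundPropagators, (3.46) p.398, dictionary (cut-off construction)] -/
def tent (n i : ℕ) : ℕ := min (i - (n + 2)) (3 * n + 2 - i)

/-- the total mass `S_n = Σ_{i < 3n+3} T_n(i)`. [cite: Balaban1985BackgroundPropagators, (3.46) p.398, dictionary (cut-off construction)] -/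
def tentSum (n : ℕ) : ℕ := ∑ i ∈ Finset.range (3 * n + 3), tent n i

/-- the profile `prof n s = 1 − (Σ_{i<s} T_n(i))/S_n`. [cite: Balaban1985BackgroundPropagators, (3.46) p.398, dictionary (cut-off construction)] -/
def prof (n s : ℕ) : ℝ := 1 - ((∑ i ∈ Finset.range s, tent n i : ℕ) : ℝ) / (tentSum n : ℝ)

/-- `T_n ≤ n`. [cite: Balaban1985BackgroundPropagators, (3.46) p.398, dictionary (cut-off construction)] -/
theorem tent_le (n i : ℕ) : tent n i ≤ n := by unfold tent; omega

/-- `T_n(i) = 0` for `i ≤ n + 2`. [cite: Balaban1985BackgroundPropagators, (3.46) p.398, dictionary (cut-off construction)] -/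
theorem tent_eq_zero_of_le {n i : ℕ} (h : i ≤ n + 2) : tent n i = 0 := by unfold tent; omega

/-- `T_n(i) = 0` for `i ≥ 3n + 2`. [cite: Balaban1985BackgroundPropagators, (3.46) p.398, dictionary (cut-off construction)] -/
theorem tent_eq_zero_of_ge {n i : ℕ} (h : 3 * n + 2 ≤ i) : tent n i = 0 := by unfold tent; omega

/-- the tent moves by at most one per step. [cite: Balaban1985BackgroundPropagators, (3.46) p.398, dictionary (cut-off construction)] -/
theorem tent_succ_sub_le (n i : ℕ) : ((tent n (i + 1) : ℕ) : ℤ) - tent n i ≤ 1 ∧ ((tent n i : ℕ) : ℤ) - tent n (i + 1) ≤ 1 := by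
  unfold tent; omega

/-- the rising half: `T_n(n+2+a) = a` for `a ≤ n`. [cite: Balaban1985BackgroundPropagators, (3.46) p.398, dictionary (cut-off construction)] -/
theorem tent_shift {n a : ℕ} (h : a ≤ n) : tent n (n + 2 + a) = a := by unfold tent; omega

/-- the partial sums vanish up to the plateau. [cite: Balaban1985BackgroundPropagators, (3.46) p.398, dictionary] -/
theorem sum_tent_eq_zero {n s : ℕ} (h : s ≤ n + 2) : ∑ i ∈ Finset.range s, tent n i = 0 :=
  Finset.sum_eq_zero fun i hi => tent_eq_zero_of_le (by have := Finset.mem_range.1 hi; omega)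

/-- the rising half of the tent: `Σ_{i < n+2+a} T = Σ_{b<a} b` for `a ≤ n + 1`. [cite: Balaban1985BackgroundPropagators, (3.46) p.398, dictionary] -/
theorem sum_tent_rise {n : ℕ} : ∀ a, a ≤ n + 1 → ∑ i ∈ Finset.range (n + 2 + a), tent n i = ∑ b ∈ Finset.range a, b := by
  intro a
  induction a with
  | zero => intro _; rw [add_zero, sum_tent_eq_zero le_rfl, Finset.range_zero, Finset.sum_empty]
  | succ a ih =>
      intro ha
      rw [← add_assoc, Finset.sum_range_succ, Finset.sum_range_succ, ih (by omega), tent_shift (by omega)]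

/-- `2·S_n ≥ n(n+1)`. [cite: Balaban1985BackgroundPropagators, (3.46) p.398, dictionary] -/
theorem tentSum_ge (n : ℕ) : n * (n + 1) ≤ 2 * tentSum n := by
  have h1 : ∑ i ∈ Finset.range (n + 2 + (n + 1)), tent n i ≤ tentSum n := by
    unfold tentSum
    exact Finset.sum_le_sum_of_subset (Finset.range_subset_range.2 (by omega))
  rw [sum_tent_rise (n + 1) le_rfl] at h1
  have h2 := Finset.sum_range_id_mul_two (n + 1)
  simp only [Nat.add_sub_cancel] at h2
  calc n * (n + 1) = (∑ b ∈ Finset.range (n + 1), b) * 2 := by rw [h2]; ring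
    _ ≤ 2 * tentSum n := by linarith

/-- `S_n > 0` for `n ≥ 1`. [cite: Balaban1985BackgroundPropagators, (3.46) p.398, dictionary] -/
theorem tentSum_pos {n : ℕ} (hn : 1 ≤ n) : 0 < tentSum n := by
  have := tentSum_ge n; nlinarith

/-- the partial sums are at most the total. [cite: Balaban1985BackgroundPropagators, (3.46) p.398, dictionary] -/
theorem sum_tent_le (n s : ℕ) : ∑ i ∈ Finset.range s, tent n i ≤ tentSum n := by
  unfold tentSum
  rcases le_or_gt s (3 * n + 3) with h | h
  · exact Finset.sum_le_sum_of_subset (Finset.range_subset_range.2 h)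
  · rw [← Finset.sum_range_add_sum_Ico _ h.le]
    have : ∑ i ∈ Finset.Ico (3 * n + 3) s, tent n i = 0 :=
      Finset.sum_eq_zero fun i hi => tent_eq_zero_of_ge (by have := (Finset.mem_Ico.1 hi).1; omega)
    omega

/-- past the support the partial sums are the total. [cite: Balaban1985BackgroundPropagators, (3.46) p.398, dictionary] -/
theorem sum_tent_eq_total {n s : ℕ} (h : 3 * n + 3 ≤ s) : ∑ i ∈ Finset.range s, tent n i = tentSum n := by
  unfold tentSum
  rw [← Finset.sum_range_add_sum_Ico _ h]
  have : ∑ i ∈ Finset.Ico (3 * n + 3) s, tent n i = 0 :=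
    Finset.sum_eq_zero fun i hi => tent_eq_zero_of_ge (by have := (Finset.mem_Ico.1 hi).1; omega)
  omega

/-- plateau: `prof n s = 1` for `s ≤ n + 2`. [cite: Balaban1985BackgroundPropagators, (3.46) p.398, dictionary] -/
theorem prof_eq_one {n s : ℕ} (h : s ≤ n + 2) : prof n s = 1 := by
  rw [prof, sum_tent_eq_zero h]; simp

/-- support: `prof n s = 0` for `s ≥ 3n + 3`. [cite: Balaban1985BackgroundPropagators, (3.46) p.398, dictionary] -/
theorem prof_eq_zero {n s : ℕ} (hn : 1 ≤ n) (h : 3 * n + 3 ≤ s) : prof n s = 0 := by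
  have hS : (0 : ℝ) < tentSum n := by exact_mod_cast tentSum_pos hn
  rw [prof, sum_tent_eq_total h, div_self hS.ne', sub_self]

/-- `0 ≤ prof n s`. [cite: Balaban1985BackgroundPropagators, (3.46) p.398, dictionary] -/
theorem prof_nonneg {n : ℕ} (hn : 1 ≤ n) (s : ℕ) : 0 ≤ prof n s := by
  have hS : (0 : ℝ) < tentSum n := by exact_mod_cast tentSum_pos hn
  have h : ((∑ i ∈ Finset.range s, tent n i : ℕ) : ℝ) ≤ tentSum n := by exact_mod_cast sum_tent_le n s
  rw [prof, sub_nonneg, div_le_one hS]; exact h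

/-- `prof n s ≤ 1`. [cite: Balaban1985BackgroundPropagators, (3.46) p.398, dictionary] -/
theorem prof_le_one (n s : ℕ) : prof n s ≤ 1 := by
  rw [prof, sub_le_self_iff]; positivity

/-- first differences: `prof n s − prof n (s+1) = T_n(s)/S_n`. [cite: Balaban1985BackgroundPropagators, (3.46) p.398, dictionary] -/
theorem prof_sub_succ (n s : ℕ) : prof n s - prof n (s + 1) = (tent n s : ℝ) / tentSum n := by
  rw [prof, prof, Finset.sum_range_succ]; push_cast; ring

/-- `|prof n (s+1) − prof n s| ≤ n/S_n`. [cite: Balaban1985BackgroundPropagators, (3.46) p.398, dictionary] -/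
theorem abs_prof_succ_sub_le {n : ℕ} (hn : 1 ≤ n) (s : ℕ) : |prof n (s + 1) - prof n s| ≤ (n : ℝ) / tentSum n := by
  have hS : (0 : ℝ) < tentSum n := by exact_mod_cast tentSum_pos hn
  rw [abs_sub_comm, prof_sub_succ, abs_of_nonneg (by positivity)]
  exact div_le_div_of_nonneg_right (by exact_mod_cast tent_le n s) hS.le

/-- second differences: `|prof n (s+2) − 2·prof n (s+1) + prof n s| ≤ 1/S_n`. [cite: Balaban1985BackgroundPropagators, (3.46) p.398, dictionary] -/
theorem abs_prof_second_le {n : ℕ} (hn : 1 ≤ n) (s : ℕ) : |prof n (s + 2) - 2 * prof n (s + 1) + prof n s| ≤ 1 / tentSum n := by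
  have hS : (0 : ℝ) < tentSum n := by exact_mod_cast tentSum_pos hn
  have e : prof n (s + 2) - 2 * prof n (s + 1) + prof n s
      = (prof n s - prof n (s + 1)) - (prof n (s + 1) - prof n (s + 1 + 1)) := by ring
  rw [e, prof_sub_succ, prof_sub_succ, ← sub_div, abs_div, abs_of_pos hS]
  refine div_le_div_of_nonneg_right ?_ hS.le
  have h := tent_succ_sub_le n s
  have h1 : (((tent n (s + 1) : ℕ) : ℤ) : ℝ) - (((tent n s : ℕ) : ℤ) : ℝ) ≤ 1 := by exact_mod_cast h.1
  have h2 : (((tent n s : ℕ) : ℤ) : ℝ) - (((tent n (s + 1) : ℕ) : ℤ) : ℝ) ≤ 1 := by exact_mod_cast h.2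
  push_cast at h1 h2
  rw [abs_le]; constructor <;> linarith

end Profile

/-! ## §2 The torus distance along one lattice step -/

section CircAbs

variable {N : ℕ} (hN : 1 ≤ N)
include hN

/-- `(t+1) mod N`. [folklore] -/
private theorem emod_succ (t : ℤ) : (t + 1) % (N : ℤ) = if t % (N : ℤ) = N - 1 then 0 else t % (N : ℤ) + 1 := by
  have h0 := Int.emod_nonneg t (show (N : ℤ) ≠ 0 by omega)
  have h1 := Int.emod_lt_of_pos t (show (0 : ℤ) < N by omega)
  rw [← Int.emod_add_emod]
  split_ifs with h
  · rw [h, sub_add_cancel, Int.emod_self]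
  · exact Int.emod_eq_of_lt (by omega) (by omega)

/-- `(t−1) mod N`. [folklore] -/
private theorem emod_pred (t : ℤ) : (t - 1) % (N : ℤ) = if t % (N : ℤ) = 0 then (N : ℤ) - 1 else t % (N : ℤ) - 1 := by
  have h0 := Int.emod_nonneg t (show (N : ℤ) ≠ 0 by omega)
  have h1 := Int.emod_lt_of_pos t (show (0 : ℤ) < N by omega)
  have e : (t - 1) % (N : ℤ) = (t % (N : ℤ) + (N - 1)) % (N : ℤ) := by
    rw [Int.emod_add_emod, show t + ((N : ℤ) - 1) = (t - 1) + (N : ℤ) * 1 by ring, Int.add_mul_emod_self_left]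
  rw [e]
  split_ifs with h
  · rw [h, zero_add]; exact Int.emod_eq_of_lt (by omega) (by omega)
  · rw [show t % (N : ℤ) + ((N : ℤ) - 1) = (t % (N : ℤ) - 1) + (N : ℤ) * 1 by ring, Int.add_mul_emod_self_left]
    exact Int.emod_eq_of_lt (by omega) (by omega)

/-- one lattice step changes the torus distance by at most one. [cite: Balaban1983RegularityDecay, p.572 («periodic conditions»), dictionary] -/
theorem circAbs_succ_le (t : ℤ) : circAbs N (t + 1) ≤ circAbs N t + 1 ∧ circAbs N t ≤ circAbs N (t + 1) + 1 := by
  have h0 := Int.emod_nonneg t (show (N : ℤ) ≠ 0 by omega)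
  have h1 := Int.emod_lt_of_pos t (show (0 : ℤ) < N by omega)
  have hs := emod_succ hN t
  unfold circAbs
  split_ifs at hs with h <;> rw [hs] <;> constructor <;> omega

/-- away from the two kinks, the torus distance is affine along three consecutive sites.
[cite: Balaban1983RegularityDecay, p.572 («periodic conditions»), dictionary] -/
theorem circAbs_three (t : ℤ) (h2 : 2 ≤ circAbs N t) (hfar : 2 * circAbs N t + 4 ≤ N) :
    (circAbs N (t - 1) = circAbs N t - 1 ∧ circAbs N (t + 1) = circAbs N t + 1) ∨
      (circAbs N (t - 1) = circAbs N t + 1 ∧ circAbs N (t + 1) = circAbs N t - 1) := by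
  have h0 := Int.emod_nonneg t (show (N : ℤ) ≠ 0 by omega)
  have h1 := Int.emod_lt_of_pos t (show (0 : ℤ) < N by omega)
  have hs := emod_succ hN t
  have hp := emod_pred hN t
  unfold circAbs at h2 hfar ⊢
  split_ifs at hs hp with ha hb hb <;> rw [hs, hp] <;> omega

end CircAbs

/-! ## §3 The one-dimensional cut-off around a centre on `ℤ/Nℤ` -/

section OneDim

/-- `g(t) = prof n (circAbs N (t − m))`: the profile of the torus distance to the centre `m`.
[cite: Balaban1985BackgroundPropagators, (3.46) p.398, dictionary (cut-off construction)] -/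
def cut1 (n N : ℕ) (m t : ℤ) : ℝ := prof n (circAbs N (t - m)).toNat

variable {n N : ℕ} (m : ℤ)

/-- `0 ≤ g`. [cite: Balaban1985BackgroundPropagators, (3.46) p.398, dictionary (cut-off construction)] -/
theorem cut1_nonneg (hn : 1 ≤ n) (t : ℤ) : 0 ≤ cut1 n N m t := prof_nonneg hn _

/-- `g ≤ 1`. [cite: Balaban1985BackgroundPropagators, (3.46) p.398, dictionary (cut-off construction)] -/
theorem cut1_le_one (t : ℤ) : cut1 n N m t ≤ 1 := prof_le_one _ _

/-- periodicity. [cite: Balaban1983RegularityDecay, p.572 («periodic conditions»), dictionary] -/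
theorem cut1_add_mul (t q : ℤ) : cut1 n N m (t + N * q) = cut1 n N m t := by
  unfold cut1; rw [show t + (N : ℤ) * q - m = (t - m) + N * q by ring, circAbs_add_mul]

/-- periodicity under reduction. [cite: Balaban1983RegularityDecay, p.572 («periodic conditions»), dictionary] -/
theorem cut1_emod (t : ℤ) : cut1 n N m (t % (N : ℤ)) = cut1 n N m t := by
  have e : t % (N : ℤ) = t + N * (-(t / (N : ℤ))) := by
    have := Int.mul_ediv_add_emod t (N : ℤ)
    linarith
  rw [e, cut1_add_mul]

/-- plateau: `g(t) = 1` when the torus distance to the centre is `≤ n + 2`. [cite: Balaban1985BackgroundPropagators, (3.46) p.398, dictionary] -/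
theorem cut1_eq_one (hN : 1 ≤ N) {t : ℤ} (h : circAbs N (t - m) ≤ n + 2) : cut1 n N m t = 1 := by
  unfold cut1
  refine prof_eq_one ?_
  have := circAbs_nonneg hN (t - m)
  omega

/-- plateau in lattice terms: `|t − m| ≤ n + 2 ⇒ g(t) = 1`. [cite: Balaban1985BackgroundPropagators, (3.46) p.398, dictionary] -/
theorem cut1_eq_one_of_abs_le (hN : 1 ≤ N) {t : ℤ} (h : |t - m| ≤ n + 2) : cut1 n N m t = 1 :=
  cut1_eq_one m hN ((circAbs_le_abs hN _).trans h)

/-- support: `g(t) ≠ 0 ⇒` the torus distance to the centre is `≤ 3n + 2`. [cite: Balaban1985BackgroundPropagators, (3.46) p.398, dictionary] -/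
theorem circAbs_le_of_cut1_ne_zero (hn : 1 ≤ n) (hN : 1 ≤ N) {t : ℤ} (h : cut1 n N m t ≠ 0) :
    circAbs N (t - m) ≤ 3 * n + 2 := by
  by_contra hlt
  rw [not_le] at hlt
  have := circAbs_nonneg hN (t - m)
  exact h (prof_eq_zero hn (by omega))

/-- first differences: `|g(t+1) − g(t)| ≤ n/S_n`. [cite: Balaban1985BackgroundPropagators, (3.46) p.398, dictionary] -/
theorem abs_cut1_succ_sub_le (hn : 1 ≤ n) (hN : 1 ≤ N) (t : ℤ) :
    |cut1 n N m (t + 1) - cut1 n N m t| ≤ (n : ℝ) / tentSum n := by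
  have hc := circAbs_succ_le hN (t - m)
  have h0 := circAbs_nonneg hN (t - m)
  have h0' := circAbs_nonneg hN (t - m + 1)
  have e : cut1 n N m (t + 1) = prof n (circAbs N (t - m + 1)).toNat := by
    unfold cut1; rw [show t + 1 - m = t - m + 1 by ring]
  rw [e]
  unfold cut1
  -- three cases: the distance moves by −1, 0 or +1
  rcases lt_trichotomy (circAbs N (t - m + 1)) (circAbs N (t - m)) with hlt | heq | hgt
  · have e : (circAbs N (t - m)).toNat = (circAbs N (t - m + 1)).toNat + 1 := by omega
    rw [e, ← abs_neg, neg_sub]; exact abs_prof_succ_sub_le hn _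
  · rw [heq, sub_self, abs_zero]
    have := tentSum_pos hn; positivity
  · have e : (circAbs N (t - m + 1)).toNat = (circAbs N (t - m)).toNat + 1 := by omega
    rw [e]; exact abs_prof_succ_sub_le hn _

/-- second differences: `|g(t+1) − 2g(t) + g(t−1)| ≤ 1/S_n` once `N ≥ 6n + 12` (the two kinks of the torus distance
lie in the plateau, resp. beyond the support). [cite: Balaban1985BackgroundPropagators, (3.46) p.398, dictionary] -/
theorem abs_cut1_second_le (hn : 1 ≤ n) (hN : 1 ≤ N) (hNn : 6 * n + 12 ≤ N) (t : ℤ) :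
    |cut1 n N m (t + 1) - 2 * cut1 n N m t + cut1 n N m (t - 1)| ≤ 1 / tentSum n := by
  have hS : (0 : ℝ) < tentSum n := by exact_mod_cast tentSum_pos hn
  have h0 := circAbs_nonneg hN (t - m)
  have hcp := circAbs_succ_le hN (t - m)
  have hcm := circAbs_succ_le hN (t - m - 1)
  rw [show t - m - 1 + 1 = t - m by ring] at hcm
  have ep : t + 1 - m = t - m + 1 := by ring
  have em : t - 1 - m = t - m - 1 := by ring
  have hpos : (0 : ℝ) ≤ 1 / tentSum n := by positivity
  by_cases hlow : circAbs N (t - m) ≤ n + 1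
  · -- plateau: all three values are `1`
    have h1 : cut1 n N m t = 1 := cut1_eq_one m hN (by omega)
    have h2 : cut1 n N m (t + 1) = 1 := cut1_eq_one m hN (by rw [ep]; omega)
    have h3 : cut1 n N m (t - 1) = 1 := cut1_eq_one m hN (by rw [em]; omega)
    calc |cut1 n N m (t + 1) - 2 * cut1 n N m t + cut1 n N m (t - 1)| = 0 := by rw [h1, h2, h3]; norm_num
      _ ≤ _ := hpos
  by_cases hhigh : 3 * n + 4 ≤ circAbs N (t - m)
  · -- beyond the support: all three values are `0`
    have z0 : cut1 n N m t = 0 := prof_eq_zero hn (by omega)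
    have z1 : cut1 n N m (t + 1) = 0 := prof_eq_zero hn (by rw [ep]; omega)
    have z2 : cut1 n N m (t - 1) = 0 := prof_eq_zero hn (by rw [em]; omega)
    calc |cut1 n N m (t + 1) - 2 * cut1 n N m t + cut1 n N m (t - 1)| = 0 := by rw [z0, z1, z2]; norm_num
      _ ≤ _ := hpos
  -- the affine region
  rw [not_le] at hlow hhigh
  have haff := circAbs_three hN (t - m) (by omega) (by omega)
  unfold cut1
  rw [ep, em]
  set c := circAbs N (t - m) with hc
  rcases haff with ⟨hm1, hp1⟩ | ⟨hm1, hp1⟩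
  · have e1 : (circAbs N (t - m + 1)).toNat = (c.toNat - 1) + 2 := by rw [hp1]; omega
    have e0 : c.toNat = (c.toNat - 1) + 1 := by omega
    have e2 : (circAbs N (t - m - 1)).toNat = c.toNat - 1 := by rw [hm1]; omega
    rw [e1, e2]
    conv_lhs => rw [e0]
    exact abs_prof_second_le hn _
  · have e1 : (circAbs N (t - m - 1)).toNat = (c.toNat - 1) + 2 := by rw [hm1]; omega
    have e0 : c.toNat = (c.toNat - 1) + 1 := by omega
    have e2 : (circAbs N (t - m + 1)).toNat = c.toNat - 1 := by rw [hp1]; omega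
    rw [e1, e2, show prof n (c.toNat - 1) - 2 * prof n c.toNat + prof n (c.toNat - 1 + 2)
      = prof n (c.toNat - 1 + 2) - 2 * prof n c.toNat + prof n (c.toNat - 1) by ring]
    conv_lhs => rw [e0]
    exact abs_prof_second_le hn _

end OneDim

/-! ## §4 Torus-close sites have `d`-close blocks; levels near a block -/

section Geometry

variable {ℓ Mh k R : ℕ} {P : Fin (d + 1) → ℕ} (D : TDomains d ℓ Mh k P R)

/-- a coordinate of the torus sup-distance: `circAbs N_μ (z_μ) ≤ torusSupNorm N z`. [folklore] -/
private theorem circAbs_le_torusSupNorm (N : Fin (d + 1) → ℕ) (z : Fin (d + 1) → ℤ) (μ : Fin (d + 1)) :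
    ((circAbs (N μ) (z μ) : ℤ) : ℝ) ≤ torusSupNorm N z :=
  Finset.le_sup' (fun i => ((circAbs (N i) (z i) : ℤ) : ℝ)) (Finset.mem_univ μ)

/-- `torusSupNorm N z ≤ ρ` iff every coordinate has `circAbs ≤ ρ`. [folklore] -/
private theorem torusSupNorm_le_iff (N : Fin (d + 1) → ℕ) (z : Fin (d + 1) → ℤ) (ρ : ℝ) :
    torusSupNorm N z ≤ ρ ↔ ∀ μ, ((circAbs (N μ) (z μ) : ℤ) : ℝ) ≤ ρ := by
  unfold torusSupNorm; rw [Finset.sup'_le_iff]; simp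

/-- a small torus distance of a difference in the window `(−2b, N − b)` is a small lattice distance (`ρ ≤ b`, `4b ≤ N`).
[folklore] -/
private theorem abs_le_of_circAbs_le {N b ρ : ℕ} (hb : ρ ≤ b) (hN : 4 * b ≤ N) {v : ℤ} (hv1 : -(2 * (b : ℤ)) < v)
    (hv2 : v < (N : ℤ) - b) (h : circAbs N v ≤ ρ) : |v| ≤ ρ := by
  have hN0 : (N : ℤ) ≠ 0 := by omega
  unfold circAbs at h
  rcases le_or_gt 0 v with hv | hv
  · rw [Int.emod_eq_of_lt hv (by omega)] at h
    rw [abs_of_nonneg hv]; omega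
  · have e : v % (N : ℤ) = v + N := by
      rw [show v = (v + N) + (N : ℤ) * (-1) by ring, Int.add_mul_emod_self_left, Int.emod_eq_of_lt (by omega) (by omega)]
      ring
    rw [e] at h
    rw [abs_of_neg hv]; omega

/-- ★ **TORUS-CLOSE SITES HAVE `d`-CLOSE BLOCKS**: if `|x − x″|_T ≤ ρ` and every site within torus distance `ρ` of `x″` has
level `≥ i`, then `d(y(x), y(x″)) ≤ (d+1)(ρ/L^i + 1)` — p21's box comparison `dist_blkOf_le_box` read in the translation
chart centring `x″` (`P_μ ≥ 4`, `ρ ≤ M·L^k`), transported back by `distT_le_dist_chart`.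
[cite: Balaban1984PropagatorsII, p.231–232 («d(x, x′) = d(y, y′) if x ∈ B^j(y) …»), (2.2) p.224, dictionary] -/
theorem distT_blkOf_le_of_torusSupNorm (hMh : 1 ≤ Mh) (hP : ∀ μ, 1 ≤ P μ) (hP4 : ∀ μ, 4 ≤ P μ) {i ρ : ℕ}
    (hρ : ρ ≤ bigSide ℓ Mh k) (x x'' : ↥(boxDom (N0 ℓ Mh k P)))
    (hx : torusSupNorm (N0 ℓ Mh k P) (x.1 - x''.1) ≤ ρ)
    (hlev : ∀ w : ↥(boxDom (N0 ℓ Mh k P)), torusSupNorm (N0 ℓ Mh k P) (w.1 - x''.1) ≤ ρ → i ≤ D.lev w.1) :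
    (((bondT D).dist (blkOf D.toDomains x) (blkOf D.toDomains x'') : ℕ) : ℝ)
      ≤ ((d : ℝ) + 1) * ((ρ : ℝ) / (((ℓ + 1) ^ i : ℕ) : ℝ) + 1) := by
  set b := bigSide ℓ Mh k with hbdef
  have hN1 : ∀ μ, 1 ≤ N0 ℓ Mh k P μ := one_le_N0 hMh hP
  have hb1 : 1 ≤ b := one_le_bigSide hMh k
  have hNb : ∀ μ, (N0 ℓ Mh k P μ : ℤ) = (b : ℤ) * P μ := fun μ => by rw [N0_eq_bigSide_mul]; push_cast; rfl
  have hN4 : ∀ μ, 4 * (b : ℤ) ≤ N0 ℓ Mh k P μ := fun μ => by rw [hNb]; have := hP4 μ; nlinarith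
  -- the centring chart
  set sv : Fin (d + 1) → ℤ := fun μ => x''.1 μ / (b : ℤ) - 1 with hsv
  set T := tshift (N0 ℓ Mh k P) (TDomains.tvec ℓ Mh k sv) with hT
  set z := T.symm x with hz
  set z'' := T.symm x'' with hz''
  have hTz : T z = x := Equiv.apply_symm_apply _ _
  have hTz'' : T z'' = x'' := Equiv.apply_symm_apply _ _
  -- coordinates of the centred site: `z″_μ = x″_μ mod b + b ∈ [b, 2b)`
  have hz''c : ∀ μ, (b : ℤ) ≤ z''.1 μ ∧ z''.1 μ < 2 * b := by
    intro μ
    have e : z''.1 μ = (x''.1 μ + -((b : ℤ) * sv μ)) % (N0 ℓ Mh k P μ : ℤ) := by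
      rw [hz'', tshift_symm_apply, tshift_val]; rfl
    have hr0 := Int.emod_nonneg (x''.1 μ) (show (b : ℤ) ≠ 0 by omega)
    have hr1 := Int.emod_lt_of_pos (x''.1 μ) (show (0 : ℤ) < b by omega)
    have hdiv := Int.mul_ediv_add_emod (x''.1 μ) (b : ℤ)
    have e2 : x''.1 μ + -((b : ℤ) * sv μ) = x''.1 μ % (b : ℤ) + b := by rw [hsv]; dsimp only; linarith
    rw [e, e2, Int.emod_eq_of_lt (by omega) (by have := hN4 μ; omega)]
    constructor <;> omega
  -- the torus distances are kept
  have hzz : torusSupNorm (N0 ℓ Mh k P) (z.1 - z''.1) ≤ ρ := by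
    have := torusSupNorm_tshift_sub (N0 ℓ Mh k P) (TDomains.tvec ℓ Mh k sv) z z''
    rw [← hT, hTz, hTz''] at this
    rw [← this]; exact hx
  -- hence the lattice distance of the representatives is `≤ ρ`
  have habs : ∀ μ, |z.1 μ - z''.1 μ| ≤ ρ := by
    intro μ
    have hzμ := (mem_boxDom.1 z.2) μ
    have h1 : ((circAbs (N0 ℓ Mh k P μ) ((z.1 - z''.1) μ) : ℤ) : ℝ) ≤ ρ :=
      (circAbs_le_torusSupNorm (N0 ℓ Mh k P) _ μ).trans hzz
    have h2 : circAbs (N0 ℓ Mh k P μ) (z.1 μ - z''.1 μ) ≤ ρ := by exact_mod_cast h1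
    exact abs_le_of_circAbs_le hρ (by exact_mod_cast hN4 μ) (by have := hz''c μ; omega)
      (by have := hz''c μ; have := hN4 μ; omega) h2
  have hsup : supNorm (z.1 - z''.1) ≤ ρ := by
    unfold supNorm; rw [Finset.sup'_le_iff]
    intro μ _; exact_mod_cast habs μ
  -- the level hypothesis in the chart
  have hlevc : ∀ w ∈ boxDom (N0 ℓ Mh k P), (∀ μ, min (z.1 μ) (z''.1 μ) ≤ w μ ∧ w μ ≤ max (z.1 μ) (z''.1 μ)) →
      i ≤ (D.chart sv).toDomains.lev w := by
    intro w hw hwin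
    rw [TDomains.toDomains_lev, D.chart_lev sv ⟨w, hw⟩]
    apply hlev
    have e : torusSupNorm (N0 ℓ Mh k P) ((tshift (N0 ℓ Mh k P) (TDomains.tvec ℓ Mh k sv) ⟨w, hw⟩).1 - x''.1)
        = torusSupNorm (N0 ℓ Mh k P) (w - z''.1) := by
      rw [← hTz'', hT]; exact torusSupNorm_tshift_sub (N0 ℓ Mh k P) _ ⟨w, hw⟩ z''
    rw [e]
    refine (torusSupNorm_le_supNorm hN1 _).trans ?_
    unfold supNorm; rw [Finset.sup'_le_iff]
    intro μ _
    have h1 := habs μ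
    have h2 := hwin μ
    rw [abs_le] at h1
    have : |(w - z''.1) μ| ≤ (ρ : ℤ) := by
      rw [Pi.sub_apply, abs_le]
      rcases le_total (z.1 μ) (z''.1 μ) with hle | hle
      · rw [min_eq_left hle, max_eq_right hle] at h2; constructor <;> linarith
      · rw [min_eq_right hle, max_eq_left hle] at h2; constructor <;> linarith
    exact_mod_cast this
  -- the box comparison in the chart, transported to the torus
  have hbox := dist_blkOf_le_box (D := (D.chart sv).toDomains) hMh hP (i := i) z z'' hlevc
  have hchart := distT_le_dist_chart (D := D) hMh hP sv (blkOf (D.chart sv).toDomains z) (blkOf (D.chart sv).toDomains z'')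
  rw [blkMap_blkOf hMh hP, blkMap_blkOf hMh hP, ← hT, hTz, hTz''] at hchart
  have hLi : (0 : ℝ) < (((ℓ + 1) ^ i : ℕ) : ℝ) := by positivity
  calc (((bondT D).dist (blkOf D.toDomains x) (blkOf D.toDomains x'') : ℕ) : ℝ)
      ≤ (((B6Geom246MultiLevelBox.bond (D.chart sv).toDomains).dist (blkOf (D.chart sv).toDomains z)
          (blkOf (D.chart sv).toDomains z'') : ℕ) : ℝ) := by exact_mod_cast hchart
    _ ≤ ((d : ℝ) + 1) * (supNorm (z.1 - z''.1) / (((ℓ + 1) ^ i : ℕ) : ℝ) + 1) := hbox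
    _ ≤ ((d : ℝ) + 1) * ((ρ : ℝ) / (((ℓ + 1) ^ i : ℕ) : ℝ) + 1) := by
        gcongr

/-- **sites torus-close to a block of level `j` have level `≥ j − 1`** ((2.2) on the torus: the territory of level
`≤ j − 2` is more than `R·M·L^{j−1}` away). [cite: Balaban1984PropagatorsII, (2.2) p.224] -/
theorem lev_ge_of_torusSupNorm_le (x'' w : ↥(boxDom (N0 ℓ Mh k P))) {ρ : ℝ}
    (hρ : ρ ≤ ((R * bigSide ℓ Mh (D.lev x''.1 - 1) : ℕ) : ℝ))
    (hw : torusSupNorm (N0 ℓ Mh k P) (w.1 - x''.1) ≤ ρ) : D.lev x''.1 - 1 ≤ D.lev w.1 := by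
  by_contra hlt
  rw [not_le] at hlt
  have h := D.sepT (D.lev x''.1 - 1) w.1 w.2 x''.1 x''.2 hlt (by omega)
  linarith

/-- **blocks at bounded `d`-distance from a block of level `j` have level `j − 1`, `j` or `j + 1`** once `R·M` exceeds the
bound (`levelGapT`). [cite: Balaban1984PropagatorsII, (2.2) p.224, (2.57) p.233] -/
theorem scale_window_of_distT_le (hMh : 1 ≤ Mh) (hP : ∀ μ, 1 ≤ P μ) {K : ℕ} (hK : K + 1 ≤ R * ((ℓ + 1) * Mh) - 1)
    (y s : ↥(bset D.toDomains)) (h : (bondT D).dist s y ≤ K) : y.1.1 ≤ s.1.1 + 1 ∧ s.1.1 ≤ y.1.1 + 1 := by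
  have hgap := levelGapT D
  have hconn := connectedT (D := D) hMh hP
  obtain ⟨p, hp⟩ := hconn.exists_walk_length_eq_dist s y
  obtain ⟨q, hq⟩ := hconn.exists_walk_length_eq_dist y s
  constructor
  · by_contra hlt
    rw [not_le] at hlt
    have := hgap (i := s.1.1 + 1) (u := s) (x := y) (by simp) (by simp only; omega) p
    omega
  · by_contra hlt
    rw [not_le] at hlt
    have := hgap (i := y.1.1 + 1) (u := y) (x := s) (by simp) (by simp only; omega) q
    rw [SimpleGraph.dist_comm] at h
    omega

end Geometry

/-! ## §5 The product cut-off of a block on the torus -/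

section Cutoff

variable {ℓ Mh k R : ℕ} {P : Fin (d + 1) → ℕ} (D : TDomains d ℓ Mh k P R)

/-- the side `L^j` of a block. [cite: Balaban1984PropagatorsII, (2.1) p.224, dictionary] -/
def side (y : ↥(bset D.toDomains)) : ℕ := (ℓ + 1) ^ y.1.1

/-- the centre `L^j·y + ⌊L^j/2⌋` of the block `(j, y)`. [cite: Balaban1984PropagatorsII, (2.1) p.224, dictionary] -/
def ctr (y : ↥(bset D.toDomains)) : Fin (d + 1) → ℤ := fun μ => corner D.toDomains y μ + ((side D y / 2 : ℕ) : ℤ)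

/-- **THE CUT-OFF OF THE BLOCK `B(y)`**: the product over the coordinates of the profile of the torus distance to the centre,
`χ_y(x) = Π_μ prof_{L^j}(circAbs N_μ (x_μ − ctr_μ))`. [cite: Balaban1985BackgroundPropagators, (3.46) p.398 («supp h ⊂ Δ̃(y)»), dictionary (cut-off construction)] -/
def cutoffT (y : ↥(bset D.toDomains)) (x : ↥(boxDom (N0 ℓ Mh k P))) : ℝ :=
  ∏ μ : Fin (d + 1), cut1 (side D y) (N0 ℓ Mh k P μ) (ctr D y μ) (x.1 μ)

variable (y : ↥(bset D.toDomains))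

/-- `1 ≤ L^j`. [cite: Balaban1984PropagatorsII, (2.1) p.224, dictionary] -/
theorem one_le_side : 1 ≤ side D y := Nat.one_le_pow _ _ (by omega)

/-- `0 ≤ χ_y`. [cite: Balaban1985BackgroundPropagators, (3.46) p.398, dictionary] -/
theorem cutoffT_nonneg (x : ↥(boxDom (N0 ℓ Mh k P))) : 0 ≤ cutoffT D y x :=
  Finset.prod_nonneg fun _ _ => cut1_nonneg _ (one_le_side D y) _

/-- `χ_y ≤ 1`. [cite: Balaban1985BackgroundPropagators, (3.46) p.398, dictionary] -/
theorem cutoffT_le_one (x : ↥(boxDom (N0 ℓ Mh k P))) : cutoffT D y x ≤ 1 :=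
  Finset.prod_le_one (fun _ _ => cut1_nonneg _ (one_le_side D y) _) fun _ _ => cut1_le_one _ _

/-- the cut-off at a translated site, read on unreduced coordinates (periodicity). [cite: Balaban1983RegularityDecay, p.572 («periodic conditions»), dictionary] -/
theorem cutoffT_tshift (v : Fin (d + 1) → ℤ) (x : ↥(boxDom (N0 ℓ Mh k P))) :
    cutoffT D y (tshift (N0 ℓ Mh k P) v x) = ∏ μ : Fin (d + 1), cut1 (side D y) (N0 ℓ Mh k P μ) (ctr D y μ) (x.1 μ + v μ) := by
  unfold cutoffT
  refine Finset.prod_congr rfl fun μ _ => ?_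
  rw [tshift_val]
  exact cut1_emod _ _

/-- a product over the coordinates with one factor changed. [folklore] -/
private theorem prod_update_sub (f : Fin (d + 1) → ℝ) (μ : Fin (d + 1)) (a : ℝ) :
    (∏ ν, Function.update f μ a ν) - ∏ ν, f ν = (a - f μ) * ∏ ν ∈ Finset.univ.erase μ, f ν := by
  rw [← Finset.mul_prod_erase Finset.univ (Function.update f μ a) (Finset.mem_univ μ),
    ← Finset.mul_prod_erase Finset.univ f (Finset.mem_univ μ), Function.update_self, sub_mul]
  congr 2
  exact Finset.prod_congr rfl fun ν hν => by rw [Function.update_of_ne (Finset.ne_of_mem_erase hν)]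

/-- the translate by `±e_μ` changes only the `μ`-th factor. [cite: Balaban1983RegularityDecay, p.572, dictionary] -/
private theorem cutoffT_tshift_unit (μ : Fin (d + 1)) (ε : ℤ) (x : ↥(boxDom (N0 ℓ Mh k P))) :
    cutoffT D y (tshift (N0 ℓ Mh k P) (ε • unitVec μ) x)
      = ∏ ν, Function.update (fun ν => cut1 (side D y) (N0 ℓ Mh k P ν) (ctr D y ν) (x.1 ν)) μ
          (cut1 (side D y) (N0 ℓ Mh k P μ) (ctr D y μ) (x.1 μ + ε)) ν := by
  rw [cutoffT_tshift]
  refine Finset.prod_congr rfl fun ν _ => ?_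
  by_cases h : ν = μ
  · subst h; rw [Function.update_self]; simp [unitVec]
  · rw [Function.update_of_ne h]; simp [unitVec, h]

/-- **THE LIPSCHITZ BOUND**: `|χ_y(x + e_μ) − χ_y(x)| ≤ 2/L^j`. [cite: Balaban1985BackgroundPropagators, (3.46) p.398, dictionary (cut-off at the block scale)] -/
theorem cutoffT_lipschitz (hMh : 1 ≤ Mh) (hP : ∀ μ, 1 ≤ P μ) (μ : Fin (d + 1)) (x : ↥(boxDom (N0 ℓ Mh k P))) :
    |cutoffT D y (tshift (N0 ℓ Mh k P) (unitVec μ) x) - cutoffT D y x| ≤ 2 / (side D y : ℝ) := by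
  have hn := one_le_side D y
  have h1 := cutoffT_tshift_unit D y μ 1 x
  rw [one_smul] at h1
  rw [h1, cutoffT, prod_update_sub, abs_mul]
  have hprod : |∏ ν ∈ Finset.univ.erase μ, cut1 (side D y) (N0 ℓ Mh k P ν) (ctr D y ν) (x.1 ν)| ≤ 1 := by
    rw [abs_of_nonneg (Finset.prod_nonneg fun ν _ => cut1_nonneg _ hn _)]
    exact Finset.prod_le_one (fun ν _ => cut1_nonneg _ hn _) fun ν _ => cut1_le_one _ _
  have hstep := abs_cut1_succ_sub_le (N := N0 ℓ Mh k P μ) (ctr D y μ) hn (one_le_N0 (ℓ := ℓ) (k := k) hMh hP μ) (x.1 μ)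
  have hS := tentSum_ge (side D y)
  have hSpos : (0 : ℝ) < tentSum (side D y) := by exact_mod_cast tentSum_pos hn
  have hnS : ((side D y : ℕ) : ℝ) / tentSum (side D y) ≤ 2 / (side D y : ℝ) := by
    rw [div_le_div_iff₀ hSpos (by positivity)]
    have : ((side D y : ℕ) : ℝ) * ((side D y : ℝ) + 1) ≤ 2 * tentSum (side D y) := by exact_mod_cast hS
    nlinarith
  calc |cut1 (side D y) (N0 ℓ Mh k P μ) (ctr D y μ) (x.1 μ + 1) - cut1 (side D y) (N0 ℓ Mh k P μ) (ctr D y μ) (x.1 μ)|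
        * |∏ ν ∈ Finset.univ.erase μ, cut1 (side D y) (N0 ℓ Mh k P ν) (ctr D y ν) (x.1 ν)|
      ≤ ((side D y : ℕ) : ℝ) / tentSum (side D y) * 1 := mul_le_mul hstep hprod (abs_nonneg _) (by positivity)
    _ ≤ 2 / (side D y : ℝ) := by rw [mul_one]; exact hnS

/-- the torus side dominates the support of the profile: `N₀_μ ≥ 6L^j + 12` (`M_h ≥ 3`, `P_μ ≥ 4`, `j ≤ k`). [cite: Balaban1984PropagatorsII, (2.1) p.224, dictionary] -/
theorem six_side_le_N0 (hℓ : 1 ≤ ℓ) (hMh : 3 ≤ Mh) (hP4 : ∀ μ, 4 ≤ P μ) (μ : Fin (d + 1)) :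
    6 * side D y + 12 ≤ N0 ℓ Mh k P μ := by
  have hj := (B6Geom246MultiLevelBox.scale_bounds D.toDomains y)
  have hL2 : 2 ≤ ℓ + 1 := by omega
  have hn1 : 1 ≤ side D y := one_le_side D y
  have hpow : side D y ≤ (ℓ + 1) ^ k := Nat.pow_le_pow_right (by omega) hj.2
  show 6 * side D y + 12 ≤ (ℓ + 1) ^ k * ((ℓ + 1) * (Mh * P μ))
  have h12 : 24 ≤ (ℓ + 1) * (Mh * P μ) := by
    have := hP4 μ
    calc 24 = 2 * (3 * 4) := by norm_num
      _ ≤ (ℓ + 1) * (Mh * P μ) := Nat.mul_le_mul hL2 (Nat.mul_le_mul hMh this)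
  have h := Nat.mul_le_mul hpow h12
  nlinarith

/-- **THE SECOND-DIFFERENCE BOUND**: `|(−Δχ_y)(x)| ≤ 2(d+1)/(L^j)²`. [cite: Balaban1985BackgroundPropagators, (3.46) p.398, dictionary (cut-off at the block scale)] -/
theorem cutoffT_perLapT_le (hℓ : 1 ≤ ℓ) (hMh : 3 ≤ Mh) (hP4 : ∀ μ, 4 ≤ P μ) (x : ↥(boxDom (N0 ℓ Mh k P))) :
    |(perLapT (N0 ℓ Mh k P) *ᵥ cutoffT D y) x| ≤ 2 * ((d : ℝ) + 1) / ((side D y : ℝ) ^ 2) := by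
  have hn := one_le_side D y
  have hMh1 : 1 ≤ Mh := le_trans (by norm_num) hMh
  have hP : ∀ μ, 1 ≤ P μ := fun μ => le_trans (by norm_num) (hP4 μ)
  have hSpos : (0 : ℝ) < tentSum (side D y) := by exact_mod_cast tentSum_pos hn
  rw [perLapT_mulVec]
  -- each direction contributes a one-dimensional second difference times a product of factors in `[0, 1]`
  have hμ : ∀ μ : Fin (d + 1), |2 * cutoffT D y x - cutoffT D y (tshift (N0 ℓ Mh k P) (unitVec μ) x)
      - cutoffT D y (tshift (N0 ℓ Mh k P) (-unitVec μ) x)| ≤ 1 / tentSum (side D y) := by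
    intro μ
    have h1 := cutoffT_tshift_unit D y μ 1 x
    have h2 := cutoffT_tshift_unit D y μ (-1) x
    rw [one_smul] at h1
    rw [neg_one_smul] at h2
    set f : Fin (d + 1) → ℝ := fun ν => cut1 (side D y) (N0 ℓ Mh k P ν) (ctr D y ν) (x.1 ν) with hf
    have e0 : cutoffT D y x = ∏ ν, f ν := rfl
    have e : 2 * cutoffT D y x - cutoffT D y (tshift (N0 ℓ Mh k P) (unitVec μ) x)
        - cutoffT D y (tshift (N0 ℓ Mh k P) (-unitVec μ) x)
        = -((cut1 (side D y) (N0 ℓ Mh k P μ) (ctr D y μ) (x.1 μ + 1) - 2 * f μ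
            + cut1 (side D y) (N0 ℓ Mh k P μ) (ctr D y μ) (x.1 μ + -1)) * ∏ ν ∈ Finset.univ.erase μ, f ν) := by
      have d1 := prod_update_sub f μ (cut1 (side D y) (N0 ℓ Mh k P μ) (ctr D y μ) (x.1 μ + 1))
      have d2 := prod_update_sub f μ (cut1 (side D y) (N0 ℓ Mh k P μ) (ctr D y μ) (x.1 μ + -1))
      rw [h1, h2, e0]
      linear_combination (-1 : ℝ) * d1 - d2
    rw [e, abs_neg, abs_mul]
    have hprod : |∏ ν ∈ Finset.univ.erase μ, f ν| ≤ 1 := by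
      rw [abs_of_nonneg (Finset.prod_nonneg fun ν _ => cut1_nonneg _ hn _)]
      exact Finset.prod_le_one (fun ν _ => cut1_nonneg _ hn _) fun ν _ => cut1_le_one _ _
    have hsec := abs_cut1_second_le (N := N0 ℓ Mh k P μ) (ctr D y μ) hn (one_le_N0 (ℓ := ℓ) (k := k) hMh1 hP μ)
      (six_side_le_N0 D y hℓ hMh hP4 μ) (x.1 μ)
    rw [show x.1 μ + -1 = x.1 μ - 1 by ring]
    calc _ ≤ 1 / (tentSum (side D y) : ℝ) * 1 := mul_le_mul hsec hprod (abs_nonneg _) (by positivity)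
      _ = _ := mul_one _
  refine (Finset.abs_sum_le_sum_abs _ _).trans ?_
  calc ∑ μ, |2 * cutoffT D y x - cutoffT D y (tshift (N0 ℓ Mh k P) (unitVec μ) x)
        - cutoffT D y (tshift (N0 ℓ Mh k P) (-unitVec μ) x)|
      ≤ ∑ _μ : Fin (d + 1), 1 / (tentSum (side D y) : ℝ) := Finset.sum_le_sum fun μ _ => hμ μ
    _ = ((d : ℝ) + 1) * (1 / tentSum (side D y)) := by rw [Finset.sum_const, Finset.card_univ, Fintype.card_fin]; simp
    _ ≤ 2 * ((d : ℝ) + 1) / ((side D y : ℝ) ^ 2) := by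
        have hS := tentSum_ge (side D y)
        have hS' : ((side D y : ℕ) : ℝ) * ((side D y : ℝ) + 1) ≤ 2 * tentSum (side D y) := by exact_mod_cast hS
        have hn' : (1 : ℝ) ≤ side D y := by exact_mod_cast hn
        rw [mul_one_div, div_le_div_iff₀ hSpos (by positivity)]
        nlinarith

/-- **THE PLATEAU**: `χ_y = 1` at every translate by a vector of sup-length `≤ 2` of a site of `B(y)`.
[cite: Balaban1985BackgroundPropagators, (3.46) p.398 («supp h ⊂ Δ̃(y)»), dictionary] -/
theorem cutoffT_plateau (hMh : 1 ≤ Mh) (hP : ∀ μ, 1 ≤ P μ) {x : ↥(boxDom (N0 ℓ Mh k P))} (hx : blkOf D.toDomains x = y)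
    (v : Fin (d + 1) → ℤ) (hv : ∀ μ, |v μ| ≤ 2) : cutoffT D y (tshift (N0 ℓ Mh k P) v x) = 1 := by
  rw [cutoffT_tshift]
  refine Finset.prod_eq_one fun μ _ => cut1_eq_one_of_abs_le _ (one_le_N0 (ℓ := ℓ) (k := k) hMh hP μ) ?_
  have hc := coord_bounds D.toDomains hx μ
  have hvμ := hv μ
  have e1 : ctr D y μ = (((ℓ + 1) ^ y.1.1 : ℕ) : ℤ) * y.1.2 μ + ((side D y / 2 : ℕ) : ℤ) := rfl
  have hn2 : ((side D y / 2 : ℕ) : ℤ) ≤ ((side D y : ℕ) : ℤ) := by exact_mod_cast Nat.div_le_self _ _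
  have hn0 : (0 : ℤ) ≤ ((side D y / 2 : ℕ) : ℤ) := by positivity
  have hside : ((side D y : ℕ) : ℤ) = (((ℓ + 1) ^ y.1.1 : ℕ) : ℤ) := rfl
  rw [abs_le] at hvμ ⊢
  rw [e1]
  constructor <;> linarith [hc.1, hc.2]

/-- the plateau at the site itself, its `e_μ`-translate and its `e_μ + e_ν`-translate (the shapes used by Caccioppoli and by
the mixed second difference). [cite: Balaban1985BackgroundPropagators, (3.46) p.398, dictionary] -/
theorem cutoffT_plateau_shifts (hMh : 1 ≤ Mh) (hP : ∀ μ, 1 ≤ P μ) {x : ↥(boxDom (N0 ℓ Mh k P))}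
    (hx : blkOf D.toDomains x = y) (μ ν : Fin (d + 1)) :
    cutoffT D y x = 1 ∧ cutoffT D y (tshift (N0 ℓ Mh k P) (unitVec μ) x) = 1 ∧
      cutoffT D y (tshift (N0 ℓ Mh k P) (unitVec ν) (tshift (N0 ℓ Mh k P) (unitVec μ) x)) = 1 := by
  have h1 : ∀ κ, |unitVec (d := d) μ κ| ≤ 2 := fun κ => by
    simp only [unitVec, Pi.single_apply]; split_ifs <;> simp
  refine ⟨?_, cutoffT_plateau D y hMh hP hx _ h1, ?_⟩
  · have := cutoffT_plateau D y hMh hP hx 0 (fun κ => by simp)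
    rwa [tshift_zero] at this
  · rw [tshift_tshift]
    refine cutoffT_plateau D y hMh hP hx _ fun κ => ?_
    simp only [Pi.add_apply, unitVec, Pi.single_apply]
    split_ifs <;> simp

/-- the centre of the block is a site of the block. [cite: Balaban1984PropagatorsII, (2.1) p.224, dictionary] -/
theorem ctr_mem : ctr D y ∈ boxDom (N0 ℓ Mh k P) := by
  have hlab := B6Geom246MultiLevelTorus.label_bounds (D := D) y
  have hcm := mem_boxDom.1 (corner_mem D.toDomains y)
  rw [mem_boxDom]
  intro μ
  have hn0 : (0 : ℤ) ≤ ((side D y / 2 : ℕ) : ℤ) := by positivity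
  have hlt : ((side D y / 2 : ℕ) : ℤ) < (((ℓ + 1) ^ y.1.1 : ℕ) : ℤ) := by
    exact_mod_cast Nat.div_lt_self (one_le_side D y) one_lt_two
  have hL : (0 : ℤ) < (((ℓ + 1) ^ y.1.1 : ℕ) : ℤ) := by positivity
  obtain ⟨h0, h1⟩ := hlab μ
  have h2 : (((ℓ + 1) ^ y.1.1 : ℕ) : ℤ) * (y.1.2 μ + 1) ≤ N0 ℓ Mh k P μ := by
    have h3 : y.1.2 μ + 1 ≤ (N0 ℓ Mh k P μ : ℤ) / (((ℓ + 1) ^ y.1.1 : ℕ) : ℤ) := h1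
    have := Int.mul_le_mul_of_nonneg_left h3 hL.le
    exact this.trans (Int.mul_ediv_self_le (by positivity))
  have e1 : ctr D y μ = (((ℓ + 1) ^ y.1.1 : ℕ) : ℤ) * y.1.2 μ + ((side D y / 2 : ℕ) : ℤ) := rfl
  have hcor : corner D.toDomains y μ = (((ℓ + 1) ^ y.1.1 : ℕ) : ℤ) * y.1.2 μ := rfl
  have hcm' := (hcm μ).1
  rw [hcor] at hcm'
  rw [e1]
  constructor
  · exact add_nonneg hcm' hn0
  · have := mul_add (((ℓ + 1) ^ y.1.1 : ℕ) : ℤ) (y.1.2 μ) 1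
    linarith

/-- the centre lies in `B(y)`. [cite: Balaban1984PropagatorsII, (2.1) p.224, dictionary] -/
theorem blkOf_ctr : blkOf D.toDomains ⟨ctr D y, ctr_mem D y⟩ = y := by
  rw [blkOf_eq_iff_blk]
  funext μ
  have hL : (0 : ℤ) < (((ℓ + 1) ^ y.1.1 : ℕ) : ℤ) := by positivity
  have hn0 : (0 : ℤ) ≤ ((side D y / 2 : ℕ) : ℤ) := by positivity
  have hlt : (((side D y / 2 : ℕ) : ℤ)) < (((ℓ + 1) ^ y.1.1 : ℕ) : ℤ) := by
    unfold side; exact_mod_cast Nat.div_lt_self (Nat.one_le_pow _ _ (by omega)) one_lt_two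
  show (corner D.toDomains y μ + ((side D y / 2 : ℕ) : ℤ)) / (((ℓ + 1) ^ y.1.1 : ℕ) : ℤ) = y.1.2 μ
  unfold corner
  rw [show (((ℓ + 1) ^ y.1.1 : ℕ) : ℤ) * y.1.2 μ + ((side D y / 2 : ℕ) : ℤ)
      = ((side D y / 2 : ℕ) : ℤ) + y.1.2 μ * (((ℓ + 1) ^ y.1.1 : ℕ) : ℤ) by ring,
    Int.add_mul_ediv_right _ _ hL.ne', Int.ediv_eq_zero_of_lt hn0 hlt, zero_add]

/-- **THE SUPPORT**: `χ_y(x) ≠ 0 ⇒ |x − ctr(y)|_T ≤ 3L^j + 2`. [cite: Balaban1985BackgroundPropagators, (3.46) p.398 («supp h ⊂ Δ̃(y)»), dictionary] -/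
theorem torusSupNorm_le_of_cutoffT_ne_zero (hMh : 1 ≤ Mh) (hP : ∀ μ, 1 ≤ P μ) {x : ↥(boxDom (N0 ℓ Mh k P))}
    (hx : cutoffT D y x ≠ 0) : torusSupNorm (N0 ℓ Mh k P) (x.1 - ctr D y) ≤ ((3 * side D y + 2 : ℕ) : ℝ) := by
  rw [torusSupNorm_le_iff]
  intro μ
  have hμ : cut1 (side D y) (N0 ℓ Mh k P μ) (ctr D y μ) (x.1 μ) ≠ 0 := by
    intro h0; apply hx
    exact Finset.prod_eq_zero (Finset.mem_univ μ) h0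
  have := circAbs_le_of_cut1_ne_zero (ctr D y μ) (one_le_side D y) (one_le_N0 hMh hP μ) hμ
  exact_mod_cast this

/-- the support bound of the side in units of the next-lower scale: `3L^j + 2 ≤ 4L·L^{j−1}` and `≤ R·M_h·L^j`.
[cite: Balaban1984PropagatorsII, (2.2) p.224, dictionary] -/
theorem support_radius_bounds (hℓ : 1 ≤ ℓ) (hMh : 3 ≤ Mh) (hR : 2 * (ℓ + 1) ≤ R) :
    ((3 * side D y + 2 : ℕ) : ℝ) / (((ℓ + 1) ^ (y.1.1 - 1) : ℕ) : ℝ) ≤ 4 * ((ℓ : ℝ) + 1) ∧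
      3 * side D y + 2 ≤ R * bigSide ℓ Mh (y.1.1 - 1) ∧ 3 * side D y + 2 ≤ bigSide ℓ Mh k := by
  have hj := (B6Geom246MultiLevelBox.scale_bounds D.toDomains y)
  obtain ⟨j', hj'⟩ : ∃ j', y.1.1 = j' + 1 := ⟨y.1.1 - 1, by omega⟩
  have hL2 : 2 ≤ ℓ + 1 := by omega
  have hpow1 : 1 ≤ (ℓ + 1) ^ j' := Nat.one_le_pow _ _ (by omega)
  have hside : side D y = (ℓ + 1) ^ j' * (ℓ + 1) := by unfold side; rw [hj', pow_succ]
  have hn1 : 1 ≤ side D y := one_le_side D y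
  refine ⟨?_, ?_, ?_⟩
  · rw [hj', Nat.add_sub_cancel, div_le_iff₀ (by positivity)]
    have hnat : 3 * side D y + 2 ≤ 4 * (ℓ + 1) * (ℓ + 1) ^ j' := by
      rw [hside]
      have := Nat.mul_le_mul hL2 hpow1
      nlinarith
    have : ((3 * side D y + 2 : ℕ) : ℝ) ≤ ((4 * (ℓ + 1) * (ℓ + 1) ^ j' : ℕ) : ℝ) := by exact_mod_cast hnat
    refine this.trans (le_of_eq ?_)
    push_cast; ring
  · rw [hj', Nat.add_sub_cancel, bigSide, ← hj']
    have hR4 : 4 ≤ R := le_trans (by omega) hR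
    have hq : side D y = (ℓ + 1) ^ y.1.1 := rfl
    rw [← hq]
    have h := Nat.mul_le_mul hR4 (Nat.mul_le_mul_right (side D y) hMh)
    omega
  · rw [bigSide, pow_succ]
    have hpow : side D y ≤ (ℓ + 1) ^ k := Nat.pow_le_pow_right (by omega) hj.2
    have h := Nat.mul_le_mul hMh (Nat.mul_le_mul hpow hL2)
    have e : Mh * ((ℓ + 1) ^ k * (ℓ + 1)) = Mh * ((ℓ + 1) ^ k * (ℓ + 1)) := rfl
    nlinarith

/-- ★ **THE SUPPORT IN BLOCK TERMS**: `χ_y(x) ≠ 0 ⇒ d(y(x), y) ≤ (d+1)(4L+1)` (`M_h ≥ 3`, `R ≥ 2L`, `P_μ ≥ 4`).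
[cite: Balaban1985BackgroundPropagators, (3.46) p.398 («supp h ⊂ Δ̃(y)»); Balaban1984PropagatorsII, (2.2) p.224, (2.46) p.231] -/
theorem distT_le_of_cutoffT_ne_zero (hℓ : 1 ≤ ℓ) (hMh : 3 ≤ Mh) (hR : 2 * (ℓ + 1) ≤ R) (hP4 : ∀ μ, 4 ≤ P μ)
    {x : ↥(boxDom (N0 ℓ Mh k P))} (hx : cutoffT D y x ≠ 0) :
    (bondT D).dist (blkOf D.toDomains x) y ≤ (d + 1) * (4 * (ℓ + 1) + 1) := by
  have hMh1 : 1 ≤ Mh := le_trans (by norm_num) hMh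
  have hP : ∀ μ, 1 ≤ P μ := fun μ => le_trans (by norm_num) (hP4 μ)
  obtain ⟨hρ1, hρ2, hρ3⟩ := support_radius_bounds D y hℓ hMh hR
  have hsupp := torusSupNorm_le_of_cutoffT_ne_zero D y hMh1 hP hx
  have hlevc : D.lev (ctr D y) = y.1.1 := lev_eq_of_blkOf_eq D.toDomains (blkOf_ctr D y)
  have hG := distT_blkOf_le_of_torusSupNorm D hMh1 hP hP4 (i := y.1.1 - 1) hρ3 x ⟨ctr D y, ctr_mem D y⟩ hsupp
    (fun w hw => by
      have := lev_ge_of_torusSupNorm_le D ⟨ctr D y, ctr_mem D y⟩ w (ρ := ((3 * side D y + 2 : ℕ) : ℝ))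
        (by rw [hlevc]; exact_mod_cast hρ2) hw
      rwa [hlevc] at this)
  rw [blkOf_ctr] at hG
  have hfin : (((bondT D).dist (blkOf D.toDomains x) y : ℕ) : ℝ) ≤ ((d : ℝ) + 1) * (4 * ((ℓ : ℝ) + 1) + 1) := by
    refine hG.trans ?_
    gcongr
  exact_mod_cast hfin

end Cutoff

end Literature.MathematicalPhysics.QuantumFieldTheory.Balaban1983to89.B9Ineq346SecondOrderTorusCutoff

end
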